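import Literature.Analysis.FluidPDE.Vorticity
import Literature.Analysis.FluidPDE.LerayHopf
import HarnessLib

/-!
# Space–time localized vorticity-direction criteria for the local enstrophy
# (Grujić–Zhang 2006, Theorems 1.1 and 1.2, Remark 1)

Topic `Analysis/FluidPDE`. Source: Z. Grujić, Q. S. Zhang, *Space-time localization of a class
of geometric criteria for preventing blow-up in the 3D NSE*, Comm. Math. Phys. **262** (2006)
555–564 [GrujicZhang2006] (held, lit key `paper:doi-10-1007-s00220-005-1437-z`; §1 pp. 555–558
with Theorems 1.1, 1.2 and Remark 1 on pp. 557–558, proofs §2–§3 pp. 558–564 read).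

The paper localizes, to an arbitrarily small backward parabolic cylinder, the hybrid
geometric–analytic family of vorticity-direction criteria of Grujić–Ruzmaikina 2004 ((1.2):
`‖ω(·)‖_{L^q}^{q/(q−1)} ∈ L¹(0,T)` and `|sin φ(ξ(x+y), ξ(x))| ≤ |y|^{1/q}`, `q ≥ 2`, whose
end-point `q = 2` is the purely geometric `½`-Hölder coherence of Beirão da Veiga–Berselli 2002),
and adds an integral (weak-`L^{6/5}` in the displacement `y`) condition on the full geometric
depletion factor. Members of the same family in the tree: the GLOBAL criteria
`constantin_fefferman` (Lipschitz), `holderHalf_direction_criterion` (BdVB02, `α = ½`),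
`holderWeight_direction_criterion` / `holder_direction_vorticityLp_criterion` (weighted and
`β < ½` hybrids) — all PROVED — and the later fully local `½`-Hölder criterion of Grujić 2009,
Thm. 1 (`grujic2009_localized_halfHolder_coherence`, any domain, two-sided threshold, no `L¹`
hypothesis on `ω₀`), of which the case `q = 2` of Theorem 1.1 below is the whole-space
predecessor. Theorem 1.1 for `q > 2` and Theorem 1.2 are not in the tree (`lean search
'GrujicZhang|Grujic.*Zhang|s00220-005-1437|depletionFactor'`, 2026-08-26: docstring mentions only).

No regularity claim about Navier–Stokes is made by this file beyond the printed theorems,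
recorded as named facts (`def … : Prop`, cite-tagged, unproved here) with proved elementary
lemmas about their hypotheses.

## What is printed (pp. 557–558, verbatim up to notation; `ν = 1`)

"For a space-time point `(x₀, t₀)`, and `r₀ > 0`, denote by `Q_{r₀}(x₀, t₀)` an open parabolic
cylinder `B(x₀, r₀) × (t₀ − r₀², t₀)`. For clarity of the exposition, we assume that solutions
are smooth in an open parabolic cylinder, and prove that the localized enstrophy remains bounded
on the closed parabolic cylinder of half the size."

**Theorem 1.1.** "Let `u` be a Leray–Hopf solution of (1.1) [the Navier–Stokes system on
`ℝ³ × (0, ∞)`, `ν = 1`, datum `u₀`], and suppose `ω₀ = curl u₀ ∈ L¹(ℝ³)`. Given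
`(x₀, t₀) ∈ ℝ³ × (0, ∞)`, assume that there exist `r₀, d, c > 0`, and `q ≥ 2`, such that
(i) `ω ∈ L^{q, q/(q−1)}(Q_{3r₀}(x₀, t₀))`,
(ii) `|sin φ(ξ(x + y, t), ξ(x, t))| ≤ c|y|^{1/q}` for `(x, t) ∈ {|ω| ≥ d} ∩ Q_{2r₀}(x₀, t₀)` and
`|y| ≤ r₀`.
Then, if `u` is smooth in the open cylinder `Q_{2r₀}(x₀, t₀)`, the localized enstrophy remains
bounded on `Q_{r₀}(x₀, t₀)`, i.e., `sup_{t ∈ (t₀−r₀², t₀)} ∫_{B(x₀,r₀)} |ω|² dx ≤ M < ∞`."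
Here `ξ = ω/|ω|` ("for a vector `v`, denote by `v̂` the unit vector in the direction of `v`"),
and `L^{a,b}(Q)` is `L^b` in time with values in `L^a` in space (cf. (1.2) and (3.7)–(3.8):
`‖ω‖_{L^{q,q/(q−1)}(Q_{3r})}` is paired by Hölder with `L^{3q/(3q−2), q}`).

"The next theorem is a generalization of Theorem 1.1 in case `q = 2` where assumption (i) is
redundant (a purely geometric case)."

**Theorem 1.2.** "Let `u` be a Leray–Hopf solution of (1.1), and suppose `ω₀ = curl u₀ ∈ L¹(ℝ³)`.
Given `(x₀, t₀) ∈ ℝ³ × (0, ∞)`, assume that there exist `r₀, d > 0` such that the function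
`λ(y) ≡ |y|⁻³ sup_{(x,t) ∈ {|ω| ≥ d} ∩ Q_{2r₀}(x₀,t₀)} |ŷ · (ξ(x + y, t) × ξ(x, t))|`  (1.3)
[`ŷ = y/|y|`] is in `L^{6/5}_w(B(0, 3r₀))`, the weak `L^{6/5}` space. Then, if `u` is smooth in
the open cylinder `Q_{2r₀}(x₀, t₀)`, the localized enstrophy remains bounded on `Q_{r₀}(x₀, t₀)`.
In other words, if `sup_{t ∈ (t₀−r₀², t₀)} ∫_{B(x₀,r₀)} |ω|² dx = ∞`, then
`‖λ‖_{L^{6/5}_w(B(0,3r₀))} = ∞`."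

**Remark 1.** "If conditions (i) and (ii) with `q = 2` in Theorem 1.1 hold, then the function
`λ` in (1.3) is bounded above by `c/|y|^{5/2}`. Hence, it is in `L^{6/5}_w(B(0, 3r₀))` and Theorem
1.2 applies."

(On (1.3): the held text layer of p. 557 garbles the display; the normalisation `|ŷ · (…)|/|y|³`
recorded here is the one forced by Remark 1 — under (ii) with `q = 2`, `|ŷ · (ξ(x+y) × ξ(x))|
≤ |sin φ| ≤ c|y|^{1/2}` gives exactly `λ ≤ c|y|^{−5/2}`, see `depletionFactor_le_of_halfHolder`
below — and by the proof of Theorem 1.2, p. 563: "`|α₁(x, t)| ≤ c ∫_{|y|≤r} K(y)|ω(x + y, t)| dy`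
where `K ∈ L^{6/5}_w`", `α₁` being the near-field part of Constantin's representation
`α(x) = (3/4π) P.V. ∫ D(ŷ, ξ(x+y), ξ(x)) |ω(x+y)| dy/|y|³` with
`|D(e₁, e₂, e₃)| = |e₁ · e₃| |Det(e₁, e₂, e₃)| ≤ |e₁ · (e₂ × e₃)|` (p. 556).)

## Transcription into the tree's vocabulary (as in `GrujicLocalizedCoherence.lean`)

* `ℝ³ = EuclideanSpace ℝ (Fin 3)`, time first, `ν = 1` (as printed). "Leray–Hopf solution of
  (1.1)": `IsLerayHopfOn T 1 0 u₀ u` on `[0, T)` for some `T ≥ t₀` — (1.1) is posed on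
  `ℝ³ × (0, ∞)`, but only the interval `(0, t₀)` enters the hypotheses, the proof ((2.4)–(3.11):
  the local energy class, Constantin's a-priori bound `‖ω(·, t)‖_{L¹(ℝ³)}` on `(0, t₀)` from
  `ω₀ ∈ L¹` [Co2], smoothness in `Q_{2r₀}`) and the conclusion; the same convention as the
  accepted `grujic2009_localized_halfHolder_coherence`. The cylinder `Q_{3r₀}(x₀, t₀)` is kept
  inside the solution's time span: `(3r₀)² ≤ t₀ ≤ T`.
* "`ω₀ = curl u₀ ∈ L¹(ℝ³)`": for a `C¹` datum, `Integrable (curl u₀)`.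
  -- TODO(general form): distributional `curl u₀ ∈ L¹` for a merely `L²` datum.
* "`u` smooth in the open cylinder `Q_{2r₀}`": `ContDiffOn ℝ ⊤ (uncurry u)` on
  `Ioo (t₀ − (2r₀)²) t₀ ×ˢ ball x₀ (2r₀)`; there `ω = curl (u t)` is the classical vorticity and
  `ξ = vorticityDirection (curl (u t)) = ‖ω‖⁻¹ • ω`.
* Theorem 1.1 (i), `ω ∈ L^{q/(q−1)}((t₀ − 9r₀², t₀); L^q(B(x₀, 3r₀)))`, concerns the vorticity on
  the LARGER cylinder `Q_{3r₀}`, where the printed `u` is only a weak solution; we record the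
  theorem for `u` smooth on the open cylinder `Q_{3r₀}` (so that (i) is a condition on the
  classical `curl (u t)`; it is NOT automatic there, the cylinder being open at `t = t₀`).
  -- TODO(general form): smoothness on `Q_{2r₀}` only, (i) for the distributional vorticity.
* (ii) `|sin φ(ξ(x+y,t), ξ(x,t))| ≤ c|y|^{1/q}` is rendered SIGN-BLINDLY as
  `‖ξ(x+y,t) × ξ(x,t)‖ ≤ c‖y‖^{1/q}` (`= |sin φ|` for unit vectors; required, as printed, for
  `(x, t)` in the high-vorticity region `{|ω| ≥ d} ∩ Q_{2r₀}` and ALL `|y| ≤ r₀` — one-sided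
  threshold; at points where `ω(x+y, t) = 0` the direction is undefined in print and the
  integrand of `α` vanishes, and the tree's junk value `ξ = 0` makes the rendered condition
  vacuously true there).
* `λ` of (1.3) is `GrujicZhang2006.depletionFactor` (an `ℝ≥0∞`-valued supremum,
  `|ŷ · (a × b)|/|y|³ = |⟪y, a × b⟫|/‖y‖⁴`), and "`λ ∈ L^{6/5}_w(B(0, 3r₀))`" is the finiteness of
  the weak quasi-norm `sup_{s>0} s · |{y ∈ B(0,3r₀) : λ(y) > s}|^{5/6}`, recorded as
  `∃ Λ < ∞, ∀ s > 0, s^{6/5} · volume {y ∈ B(0, 3r₀) : s < λ(y)} ≤ Λ` (distribution-function form,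
  as for the tree's weak-`L³` hypotheses, e.g. `AlbrittonBarker2019_liouville_weakL3_backward`).
* Conclusions: `∃ M, ∀ t ∈ (t₀ − r₀², t₀), ∫_{B(x₀,r₀)} ‖curl (u t) x‖² dx ≤ M` (the integrand is
  continuous on the ball for these `t`, so the Bochner integral is the printed one).

## Contents

* `GrujicZhang2006.depletionFactor` — `λ` of (1.3); `….depletionFactor_le_of_bound` (a uniform
  pointwise bound on the triple products bounds `λ`), `….abs_inner_cross_le` and
  `….depletionFactor_le_of_halfHolder` (**Remark 1**, pointwise part: (ii) with `q = 2` gives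
  `λ(y) ≤ c|y|^{−5/2}`) — proved.
* `grujicZhang2006_localized_hybrid_coherence` — **Theorem 1.1** (named fact).
* `grujicZhang2006_localized_integral_coherence` — **Theorem 1.2** (named fact).

## References

* Z. Grujić, Q. S. Zhang, Comm. Math. Phys. 262 (2006) 555–564, doi:10.1007/s00220-005-1437-z:
  §1 (1.2), Thm. 1.1, Thm. 1.2, (1.3), Remark 1 (pp. 556–558); §3 (3.5)–(3.11) (pp. 562–564).
  [GrujicZhang2006]
* Z. Grujić, A. Ruzmaikina, Indiana Univ. Math. J. 53 (2004) 1073–1080 (the global hybrid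
  conditions (1.2)). [GrujicRuzmaikina2004]
* Z. Grujić, Comm. Math. Phys. 290 (2009) 861–870, Thm. 1 (tree fact
  `grujic2009_localized_halfHolder_coherence`). [Grujic2009]
* P. Constantin, Comm. Math. Phys. 129 (1990) 241–266 (a-priori `L¹` bound on the vorticity,
  [Co2] of the source). [Constantin1990]
-/

noncomputable section

open MeasureTheory Set Function Filter Metric
open scoped ENNReal RealInnerProductSpace
open _root_.Topology

namespace Literature.Analysis.FluidPDE

namespace GrujicZhang2006

/-- **Grujić–Zhang's localized geometric depletion factor `λ(y)`** ((1.3) of Grujić–Zhang 2006):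
`λ(y) = |y|⁻³ sup |ŷ · (ξ(x + y, t) × ξ(x, t))|`, the supremum taken over the high-vorticity
points `(x, t) ∈ {|ω| ≥ d} ∩ Q_{2r₀}(x₀, t₀)` of the backward cylinder, where `ω = curl u(t, ·)`,
`ξ = ω/|ω|` (`vorticityDirection`) and `ŷ = y/|y|`; written `|⟪y, ξ(x+y,t) × ξ(x,t)⟫| / ‖y‖⁴` and
valued in `ℝ≥0∞` (value `0` at `y = 0` and when the high-vorticity region is empty). It
majorizes the kernel `|D(ŷ, ξ(x+y), ξ(x))|/|y|³` of the near-field part of Constantin's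
representation of the stretching factor `α` (p. 556, p. 562 (3.5)).
[cite: GrujicZhang2006, (1.3) (p. 557) with §1 p. 556 and §3 (3.5)] -/
def depletionFactor (u : ℝ → EuclideanSpace ℝ (Fin 3) → EuclideanSpace ℝ (Fin 3))
    (x₀ : EuclideanSpace ℝ (Fin 3)) (t₀ r₀ d : ℝ) (y : EuclideanSpace ℝ (Fin 3)) : ℝ≥0∞ :=
  ⨆ (t : ℝ) (_ : t ∈ Ioo (t₀ - (2 * r₀) ^ 2) t₀) (x : EuclideanSpace ℝ (Fin 3))
    (_ : x ∈ ball x₀ (2 * r₀)) (_ : d ≤ ‖curl (u t) x‖),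
    ENNReal.ofReal
      (|⟪y, cross (vorticityDirection (curl (u t)) (x + y)) (vorticityDirection (curl (u t)) x)⟫|
        / ‖y‖ ^ 4)

/-- A uniform bound on the triple products over the high-vorticity region bounds `λ(y)`
(definition of the supremum (1.3)). [cite: GrujicZhang2006, (1.3) (p. 557)] -/
theorem depletionFactor_le_of_bound
    {u : ℝ → EuclideanSpace ℝ (Fin 3) → EuclideanSpace ℝ (Fin 3)} {x₀ : EuclideanSpace ℝ (Fin 3)}
    {t₀ r₀ d : ℝ} {y : EuclideanSpace ℝ (Fin 3)} {B : ℝ}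
    (h : ∀ t ∈ Ioo (t₀ - (2 * r₀) ^ 2) t₀, ∀ x ∈ ball x₀ (2 * r₀), d ≤ ‖curl (u t) x‖ →
      |⟪y, cross (vorticityDirection (curl (u t)) (x + y)) (vorticityDirection (curl (u t)) x)⟫|
        / ‖y‖ ^ 4 ≤ B) :
    depletionFactor u x₀ t₀ r₀ d y ≤ ENNReal.ofReal B := by
  refine iSup_le fun t => iSup_le fun ht => iSup_le fun x => iSup_le fun hx => iSup_le fun hd => ?_
  exact ENNReal.ofReal_le_ofReal (h t ht x hx hd)

/-- `|⟪y, a × b⟫| ≤ ‖y‖ ‖a × b‖` and `‖a × b‖ ≤ ‖a‖ ‖b‖` (`|sin| ≤ 1`): the triple product of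
(1.3) is at most `‖y‖ ‖a × b‖`, and `‖a × b‖ ≤ 1` for vectors of norm `≤ 1` (p. 556:
"`|D(ŷ, ξ(x+y), ξ(x))| ≤ |sin φ(ξ(x+y), ξ(x))|`"). [cite: GrujicZhang2006, §1 p. 556] -/
theorem abs_inner_cross_le (y a b : EuclideanSpace ℝ (Fin 3)) :
    |⟪y, cross a b⟫| ≤ ‖y‖ * ‖cross a b‖ ∧ ‖cross a b‖ ≤ ‖a‖ * ‖b‖ := by
  refine ⟨abs_real_inner_le_norm y (cross a b), ?_⟩
  rw [norm_cross]
  have h1 : Real.sin (InnerProductGeometry.angle a b) ≤ 1 := Real.sin_le_one _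
  have h2 : 0 ≤ ‖a‖ * ‖b‖ := mul_nonneg (norm_nonneg _) (norm_nonneg _)
  nlinarith

/-- **Grujić–Zhang 2006, Remark 1 (pointwise part).** If the `½`-Hölder coherence (ii) of
Theorem 1.1 with `q = 2` holds — `‖ξ(x+y,t) × ξ(x,t)‖ ≤ c‖y‖^{1/2}` for `(x,t)` in
`{|ω| ≥ d} ∩ Q_{2r₀}(x₀,t₀)` and `|y| ≤ r₀` — then `λ(y) ≤ c/|y|^{5/2}` for `0 < |y| ≤ r₀`
("the function `λ` in (1.3) is bounded above by `c/|y|^{5/2}`"; whence `λ ∈ L^{6/5}_w` and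
Theorem 1.2 applies). [cite: GrujicZhang2006, Remark 1 (p. 558)] -/
theorem depletionFactor_le_of_halfHolder
    {u : ℝ → EuclideanSpace ℝ (Fin 3) → EuclideanSpace ℝ (Fin 3)} {x₀ : EuclideanSpace ℝ (Fin 3)}
    {t₀ r₀ d c : ℝ}
    (hii : ∀ t ∈ Ioo (t₀ - (2 * r₀) ^ 2) t₀, ∀ x ∈ ball x₀ (2 * r₀), d ≤ ‖curl (u t) x‖ →
      ∀ y : EuclideanSpace ℝ (Fin 3), ‖y‖ ≤ r₀ →
        ‖cross (vorticityDirection (curl (u t)) (x + y)) (vorticityDirection (curl (u t)) x)‖ ≤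
          c * Real.sqrt ‖y‖)
    {y : EuclideanSpace ℝ (Fin 3)} (hy0 : y ≠ 0) (hy : ‖y‖ ≤ r₀) :
    depletionFactor u x₀ t₀ r₀ d y ≤ ENNReal.ofReal (c / ‖y‖ ^ (5 / 2 : ℝ)) := by
  have hny : 0 < ‖y‖ := norm_pos_iff.2 hy0
  refine depletionFactor_le_of_bound fun t ht x hx hdx => ?_
  set a := vorticityDirection (curl (u t)) (x + y)
  set b := vorticityDirection (curl (u t)) x
  have h1 : |⟪y, cross a b⟫| ≤ ‖y‖ * ‖cross a b‖ := (abs_inner_cross_le y a b).1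
  have h2 : ‖cross a b‖ ≤ c * Real.sqrt ‖y‖ := hii t ht x hx hdx y hy
  have h3 : |⟪y, cross a b⟫| ≤ ‖y‖ * (c * Real.sqrt ‖y‖) :=
    h1.trans (mul_le_mul_of_nonneg_left h2 hny.le)
  -- `‖y‖ * c * √‖y‖ / ‖y‖⁴ = c / ‖y‖^{5/2}`
  have hsq : Real.sqrt ‖y‖ = ‖y‖ ^ (1 / 2 : ℝ) := Real.sqrt_eq_rpow ‖y‖
  have h4 : ‖y‖ ^ 4 = ‖y‖ ^ (5 / 2 : ℝ) * (‖y‖ * ‖y‖ ^ (1 / 2 : ℝ)) := by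
    have : ‖y‖ ^ (4 : ℝ) = ‖y‖ ^ (5 / 2 : ℝ) * (‖y‖ ^ (1 : ℝ) * ‖y‖ ^ (1 / 2 : ℝ)) := by
      rw [← Real.rpow_add hny, ← Real.rpow_add hny]; norm_num
    simpa [Real.rpow_natCast, Real.rpow_one] using this
  have hpos : 0 < ‖y‖ * ‖y‖ ^ (1 / 2 : ℝ) := mul_pos hny (Real.rpow_pos_of_pos hny _)
  have hpos' : 0 < ‖y‖ ^ (5 / 2 : ℝ) := Real.rpow_pos_of_pos hny _
  rw [div_le_div_iff₀ (pow_pos hny 4) hpos']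
  calc |⟪y, cross a b⟫| * ‖y‖ ^ (5 / 2 : ℝ)
      ≤ ‖y‖ * (c * ‖y‖ ^ (1 / 2 : ℝ)) * ‖y‖ ^ (5 / 2 : ℝ) := by
        rw [hsq] at h3; exact mul_le_mul_of_nonneg_right h3 hpos'.le
    _ = c * ‖y‖ ^ 4 := by rw [h4]; ring

end GrujicZhang2006

/-- **Grujić–Zhang 2006, Theorem 1.1 (localized hybrid geometric–analytic criterion).** Let `u`
be a Leray–Hopf weak solution of the unforced Navier–Stokes equations (`ν = 1`) on `ℝ³ × [0, T)`
from a `C¹` datum `u₀` with `curl u₀ ∈ L¹(ℝ³)`. Let `(x₀, t₀)` be a space–time point and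
`r₀ > 0` with `(3r₀)² ≤ t₀ ≤ T`, and let `d, c > 0`, `q ≥ 2`. Suppose `u` is smooth on the open
backward cylinder `Q_{3r₀}(x₀, t₀) = B(x₀, 3r₀) × (t₀ − 9r₀², t₀)` (printed: on `Q_{2r₀}`, see
the module docstring), and
(i) `ω = curl u ∈ L^{q/(q−1)}((t₀ − 9r₀², t₀); L^q(B(x₀, 3r₀)))`:
`∫_{t₀−9r₀²}^{t₀} (∫_{B(x₀,3r₀)} |ω(x,t)|^q dx)^{1/(q−1)} dt < ∞`;
(ii) `|sin φ(ξ(x+y,t), ξ(x,t))| = ‖ξ(x+y,t) × ξ(x,t)‖ ≤ c|y|^{1/q}` for all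
`(x, t) ∈ {|ω| ≥ d} ∩ Q_{2r₀}(x₀, t₀)` and all `|y| ≤ r₀` (`ξ = ω/|ω| = vorticityDirection`).
Then the localized enstrophy stays bounded up to `t = t₀`:
`sup_{t ∈ (t₀−r₀², t₀)} ∫_{B(x₀,r₀)} |ω|² dx < ∞`. The case `q = 2` is the purely geometric
localized `½`-Hölder criterion ((i) is then implied by the energy class); cf. the later any-domain
version `grujic2009_localized_halfHolder_coherence`. Not proved here; users take
`(h : grujicZhang2006_localized_hybrid_coherence)`.
-- TODO(general form): `u` smooth on `Q_{2r₀}` only with (i) for the distributional vorticity on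
`Q_{3r₀}`; distributional `curl u₀ ∈ L¹`.
[cite: GrujicZhang2006, Thm. 1.1 (p. 557), with §1 (1.2) (p. 556) and the proof §2–§3 (pp. 558–563)] -/
def grujicZhang2006_localized_hybrid_coherence : Prop :=
  ∀ ⦃T : ℝ⦄, 0 < T →
    ∀ ⦃u₀ : EuclideanSpace ℝ (Fin 3) → EuclideanSpace ℝ (Fin 3)⦄
      ⦃u : ℝ → EuclideanSpace ℝ (Fin 3) → EuclideanSpace ℝ (Fin 3)⦄,
    IsLerayHopfOn T 1 0 u₀ u →
    ContDiff ℝ 1 u₀ → Integrable (curl u₀) →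
    ∀ (x₀ : EuclideanSpace ℝ (Fin 3)) (t₀ r₀ d c q : ℝ),
      0 < r₀ → (3 * r₀) ^ 2 ≤ t₀ → t₀ ≤ T → 0 < d → 0 < c → 2 ≤ q →
    -- `u` is smooth on the open parabolic cylinder `Q_{3r₀}(x₀, t₀)`
    ContDiffOn ℝ (⊤ : ℕ∞) (uncurry u) (Ioo (t₀ - (3 * r₀) ^ 2) t₀ ×ˢ ball x₀ (3 * r₀)) →
    -- (i) `ω ∈ L^{q/(q-1)}_t L^q_x (Q_{3r₀})`
    (∫⁻ t in Ioo (t₀ - (3 * r₀) ^ 2) t₀,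
        (∫⁻ x in ball x₀ (3 * r₀), ‖curl (u t) x‖ₑ ^ q) ^ (1 / (q - 1)) < ∞) →
    -- (ii) `1/q`-Hölder (sign-blind) coherence off the high-vorticity points of `Q_{2r₀}`
    (∀ t ∈ Ioo (t₀ - (2 * r₀) ^ 2) t₀, ∀ x ∈ ball x₀ (2 * r₀), d ≤ ‖curl (u t) x‖ →
      ∀ y : EuclideanSpace ℝ (Fin 3), ‖y‖ ≤ r₀ →
        ‖cross (vorticityDirection (curl (u t)) (x + y)) (vorticityDirection (curl (u t)) x)‖ ≤
          c * ‖y‖ ^ (1 / q)) →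
    -- the localized enstrophy stays bounded up to `t = t₀`
    ∃ M : ℝ, ∀ t ∈ Ioo (t₀ - r₀ ^ 2) t₀, ∫ x in ball x₀ r₀, ‖curl (u t) x‖ ^ 2 ≤ M

/-- **Grujić–Zhang 2006, Theorem 1.2 (localized integral condition on the vorticity
directions).** Let `u` be a Leray–Hopf weak solution of the unforced Navier–Stokes equations
(`ν = 1`) on `ℝ³ × [0, T)` from a `C¹` datum `u₀` with `curl u₀ ∈ L¹(ℝ³)`. Let `(x₀, t₀)` be a
space–time point, `r₀ > 0` with `(3r₀)² ≤ t₀ ≤ T`, and `d > 0`. Suppose `u` is smooth on the open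
backward cylinder `Q_{2r₀}(x₀, t₀)` and the depletion factor
`λ(y) = |y|⁻³ sup_{(x,t) ∈ {|ω| ≥ d} ∩ Q_{2r₀}(x₀,t₀)} |ŷ · (ξ(x+y,t) × ξ(x,t))|`
(`GrujicZhang2006.depletionFactor`) lies in weak `L^{6/5}` on `B(0, 3r₀)`:
`sup_{s>0} s^{6/5} · |{y ∈ B(0, 3r₀) : λ(y) > s}| < ∞`. Then the localized enstrophy stays
bounded up to `t = t₀`: `sup_{t ∈ (t₀−r₀², t₀)} ∫_{B(x₀,r₀)} |ω|² dx < ∞` ("In other words, if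
[it] `= ∞`, then `‖λ‖_{L^{6/5}_w(B(0,3r₀))} = ∞`"). By Remark 1
(`GrujicZhang2006.depletionFactor_le_of_halfHolder`) this contains Theorem 1.1 with `q = 2`. Not
proved here; users take `(h : grujicZhang2006_localized_integral_coherence)`.
-- TODO(general form): distributional `curl u₀ ∈ L¹` for an `L²` datum.
[cite: GrujicZhang2006, Thm. 1.2 and (1.3) (pp. 557–558), proof §3 (pp. 563–564)] -/
def grujicZhang2006_localized_integral_coherence : Prop :=
  ∀ ⦃T : ℝ⦄, 0 < T →
    ∀ ⦃u₀ : EuclideanSpace ℝ (Fin 3) → EuclideanSpace ℝ (Fin 3)⦄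
      ⦃u : ℝ → EuclideanSpace ℝ (Fin 3) → EuclideanSpace ℝ (Fin 3)⦄,
    IsLerayHopfOn T 1 0 u₀ u →
    ContDiff ℝ 1 u₀ → Integrable (curl u₀) →
    ∀ (x₀ : EuclideanSpace ℝ (Fin 3)) (t₀ r₀ d : ℝ),
      0 < r₀ → (3 * r₀) ^ 2 ≤ t₀ → t₀ ≤ T → 0 < d →
    -- `u` is smooth on the open parabolic cylinder `Q_{2r₀}(x₀, t₀)`
    ContDiffOn ℝ (⊤ : ℕ∞) (uncurry u) (Ioo (t₀ - (2 * r₀) ^ 2) t₀ ×ˢ ball x₀ (2 * r₀)) →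
    -- `λ ∈ L^{6/5}_w (B(0, 3r₀))` (distribution-function form of the weak quasi-norm)
    (∃ Λ : ℝ≥0∞, Λ < ∞ ∧ ∀ s : ℝ, 0 < s →
      ENNReal.ofReal s ^ (6 / 5 : ℝ) *
          volume {y ∈ ball (0 : EuclideanSpace ℝ (Fin 3)) (3 * r₀) |
            ENNReal.ofReal s < GrujicZhang2006.depletionFactor u x₀ t₀ r₀ d y} ≤ Λ) →
    -- the localized enstrophy stays bounded up to `t = t₀`
    ∃ M : ℝ, ∀ t ∈ Ioo (t₀ - r₀ ^ 2) t₀, ∫ x in ball x₀ r₀, ‖curl (u t) x‖ ^ 2 ≤ M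


/-! ### Remark 1 in full: Theorem 1.2 contains Theorem 1.1 at `q = 2` -/

namespace GrujicZhang2006

/-- `‖ξ‖ ≤ 1`: the direction field is a unit vector where `ω ≠ 0` and the junk value `0`
elsewhere. [cite: GrujicZhang2006, §1 p. 556 (unit vectors `ξ = ω/|ω|`)] -/
theorem norm_vorticityDirection_le_one
    (ω : EuclideanSpace ℝ (Fin 3) → EuclideanSpace ℝ (Fin 3)) (x : EuclideanSpace ℝ (Fin 3)) :
    ‖vorticityDirection ω x‖ ≤ 1 := by
  by_cases hx : ω x = 0
  · rw [(vorticityDirection_eq_zero_iff ω x).2 hx, norm_zero]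
    exact zero_le_one
  · exact (norm_vorticityDirection ω hx).le

/-- The crude bound `λ(y) ≤ 1/|y|³` for `y ≠ 0` (`|ŷ · (ξ(x+y) × ξ(x))| ≤ 1`), used for the
displacements `r₀ < |y| < 3r₀` not covered by condition (ii).
[cite: GrujicZhang2006, (1.3) and §1 p. 556 (`|D| ≤ |sin φ| ≤ 1`)] -/
theorem depletionFactor_le_inv_cube
    {u : ℝ → EuclideanSpace ℝ (Fin 3) → EuclideanSpace ℝ (Fin 3)} {x₀ : EuclideanSpace ℝ (Fin 3)}
    {t₀ r₀ d : ℝ} {y : EuclideanSpace ℝ (Fin 3)} (hy0 : y ≠ 0) :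
    depletionFactor u x₀ t₀ r₀ d y ≤ ENNReal.ofReal (1 / ‖y‖ ^ 3) := by
  have hny : 0 < ‖y‖ := norm_pos_iff.2 hy0
  refine depletionFactor_le_of_bound fun t _ x _ _ => ?_
  set a := vorticityDirection (curl (u t)) (x + y)
  set b := vorticityDirection (curl (u t)) x
  obtain ⟨h1, h2⟩ := abs_inner_cross_le y a b
  have ha : ‖a‖ ≤ 1 := norm_vorticityDirection_le_one _ _
  have hb : ‖b‖ ≤ 1 := norm_vorticityDirection_le_one _ _
  have hab : ‖cross a b‖ ≤ 1 :=
    h2.trans (mul_le_one₀ ha (norm_nonneg b) hb)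
  have h3 : |⟪y, cross a b⟫| ≤ ‖y‖ :=
    h1.trans (mul_le_of_le_one_right hny.le hab)
  rw [div_le_div_iff₀ (pow_pos hny 4) (pow_pos hny 3)]
  calc |⟪y, cross a b⟫| * ‖y‖ ^ 3 ≤ ‖y‖ * ‖y‖ ^ 3 :=
        mul_le_mul_of_nonneg_right h3 (pow_pos hny 3).le
    _ = 1 * ‖y‖ ^ 4 := by ring

/-- `λ(0) = 0` (every term of the supremum is `|⟪0, ·⟫|/0 = 0`). [cite: GrujicZhang2006, (1.3) (p. 557)] -/
theorem depletionFactor_zero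
    {u : ℝ → EuclideanSpace ℝ (Fin 3) → EuclideanSpace ℝ (Fin 3)} {x₀ : EuclideanSpace ℝ (Fin 3)}
    {t₀ r₀ d : ℝ} : depletionFactor u x₀ t₀ r₀ d 0 = 0 := by
  refine le_antisymm ?_ zero_le
  calc depletionFactor u x₀ t₀ r₀ d 0 ≤ ENNReal.ofReal 0 :=
        depletionFactor_le_of_bound fun t _ x _ _ => by simp
    _ = 0 := ENNReal.ofReal_zero

/-- **The super-level sets of `λ` under condition (ii) with `q = 2`.** If (ii) of Theorem 1.1 holds
with `q = 2`, then for `s > 0` the set `{y ∈ B(0, 3r₀) : λ(y) > s}` is contained in the ball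
`B(0, (c/s)^{2/5})` (from `λ ≤ c|y|^{−5/2}` on `|y| ≤ r₀`, Remark 1) together with, when
`s < r₀⁻³`, the ball `B(0, 3r₀)` (from `λ ≤ |y|⁻³` on `|y| > r₀`).
[cite: GrujicZhang2006, Remark 1 (p. 558)] -/
theorem superlevel_depletionFactor_subset_of_halfHolder
    {u : ℝ → EuclideanSpace ℝ (Fin 3) → EuclideanSpace ℝ (Fin 3)} {x₀ : EuclideanSpace ℝ (Fin 3)}
    {t₀ r₀ d c : ℝ} (hr₀ : 0 < r₀) (hc : 0 < c)
    (hii : ∀ t ∈ Ioo (t₀ - (2 * r₀) ^ 2) t₀, ∀ x ∈ ball x₀ (2 * r₀), d ≤ ‖curl (u t) x‖ →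
      ∀ y : EuclideanSpace ℝ (Fin 3), ‖y‖ ≤ r₀ →
        ‖cross (vorticityDirection (curl (u t)) (x + y)) (vorticityDirection (curl (u t)) x)‖ ≤
          c * Real.sqrt ‖y‖)
    {s : ℝ} (hs : 0 < s) :
    {y ∈ ball (0 : EuclideanSpace ℝ (Fin 3)) (3 * r₀) |
        ENNReal.ofReal s < depletionFactor u x₀ t₀ r₀ d y} ⊆
      ball (0 : EuclideanSpace ℝ (Fin 3)) ((c / s) ^ (2 / 5 : ℝ)) ∪
        (if s < (r₀ ^ 3)⁻¹ then ball (0 : EuclideanSpace ℝ (Fin 3)) (3 * r₀) else ∅) := by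
  intro y hy
  obtain ⟨hyball, hys⟩ := hy
  have hy0 : y ≠ 0 := by
    rintro rfl
    rw [depletionFactor_zero] at hys
    exact (not_lt.2 zero_le) hys
  have hny : 0 < ‖y‖ := norm_pos_iff.2 hy0
  by_cases hyr : ‖y‖ ≤ r₀
  · -- `s < λ(y) ≤ c/‖y‖^{5/2}` ⇒ `‖y‖ < (c/s)^{2/5}`
    left
    have hle := depletionFactor_le_of_halfHolder hii hy0 hyr
    have hlt : ENNReal.ofReal s < ENNReal.ofReal (c / ‖y‖ ^ (5 / 2 : ℝ)) := hys.trans_le hle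
    have hpos : 0 < ‖y‖ ^ (5 / 2 : ℝ) := Real.rpow_pos_of_pos hny _
    have hlt' : s < c / ‖y‖ ^ (5 / 2 : ℝ) := (ENNReal.ofReal_lt_ofReal_iff (div_pos hc hpos)).1 hlt
    have h1 : ‖y‖ ^ (5 / 2 : ℝ) < c / s := by
      rw [lt_div_iff₀ hs]; rw [lt_div_iff₀ hpos] at hlt'; linarith
    rw [mem_ball, dist_zero_right]
    have h2 : (‖y‖ ^ (5 / 2 : ℝ)) ^ (2 / 5 : ℝ) < (c / s) ^ (2 / 5 : ℝ) :=
      Real.rpow_lt_rpow hpos.le h1 (by norm_num)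
    have h3 : (‖y‖ ^ (5 / 2 : ℝ)) ^ (2 / 5 : ℝ) = ‖y‖ := by
      rw [← Real.rpow_mul hny.le]; norm_num
    rwa [h3] at h2
  · -- `s < λ(y) ≤ 1/‖y‖³ < 1/r₀³`
    right
    rw [not_le] at hyr
    have hle := depletionFactor_le_inv_cube (u := u) (x₀ := x₀) (t₀ := t₀) (r₀ := r₀) (d := d) hy0
    have hlt : ENNReal.ofReal s < ENNReal.ofReal (1 / ‖y‖ ^ 3) := hys.trans_le hle
    have hlt' : s < 1 / ‖y‖ ^ 3 :=
      (ENNReal.ofReal_lt_ofReal_iff (div_pos one_pos (pow_pos hny 3))).1 hlt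
    have hcube : r₀ ^ 3 < ‖y‖ ^ 3 := by gcongr
    have hs' : s < (r₀ ^ 3)⁻¹ := by
      rw [one_div] at hlt'
      exact hlt'.trans (by gcongr)
    rw [if_pos hs']
    exact hyball

end GrujicZhang2006

/-- **Grujić–Zhang 2006, Remark 1 in full: Theorem 1.2 implies Theorem 1.1 in the purely geometric
case `q = 2`** (with the printed smoothness hypothesis on `Q_{2r₀}` only, and no condition (i)).
From the fact `grujicZhang2006_localized_integral_coherence`: under the `½`-Hölder coherence
`‖ξ(x+y,t) × ξ(x,t)‖ ≤ c|y|^{1/2}` for `(x, t) ∈ {|ω| ≥ d} ∩ Q_{2r₀}(x₀, t₀)`, `|y| ≤ r₀`, the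
depletion factor obeys `λ ≤ c|y|^{−5/2}` there (`depletionFactor_le_of_halfHolder`) and `λ ≤ |y|⁻³`
beyond, so `sup_s s^{6/5}|{y ∈ B(0,3r₀) : λ > s}| ≤ c^{6/5}|B(0,1)| + r₀^{−18/5}|B(0,3r₀)| < ∞`,
i.e. `λ ∈ L^{6/5}_w(B(0, 3r₀))`, "and Theorem 1.2 applies".
[cite: GrujicZhang2006, Remark 1 (p. 558) with Thms. 1.1–1.2 (p. 557)] -/
theorem grujicZhang2006_localized_halfHolder_of_integral
    (h : grujicZhang2006_localized_integral_coherence) :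
    ∀ ⦃T : ℝ⦄, 0 < T →
      ∀ ⦃u₀ : EuclideanSpace ℝ (Fin 3) → EuclideanSpace ℝ (Fin 3)⦄
        ⦃u : ℝ → EuclideanSpace ℝ (Fin 3) → EuclideanSpace ℝ (Fin 3)⦄,
      IsLerayHopfOn T 1 0 u₀ u →
      ContDiff ℝ 1 u₀ → Integrable (curl u₀) →
      ∀ (x₀ : EuclideanSpace ℝ (Fin 3)) (t₀ r₀ d c : ℝ),
        0 < r₀ → (3 * r₀) ^ 2 ≤ t₀ → t₀ ≤ T → 0 < d → 0 < c →
      ContDiffOn ℝ (⊤ : ℕ∞) (uncurry u) (Ioo (t₀ - (2 * r₀) ^ 2) t₀ ×ˢ ball x₀ (2 * r₀)) →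
      (∀ t ∈ Ioo (t₀ - (2 * r₀) ^ 2) t₀, ∀ x ∈ ball x₀ (2 * r₀), d ≤ ‖curl (u t) x‖ →
        ∀ y : EuclideanSpace ℝ (Fin 3), ‖y‖ ≤ r₀ →
          ‖cross (vorticityDirection (curl (u t)) (x + y)) (vorticityDirection (curl (u t)) x)‖ ≤
            c * Real.sqrt ‖y‖) →
      ∃ M : ℝ, ∀ t ∈ Ioo (t₀ - r₀ ^ 2) t₀, ∫ x in ball x₀ r₀, ‖curl (u t) x‖ ^ 2 ≤ M := by
  intro T hT u₀ u hLH hu₀ hω₀ x₀ t₀ r₀ d c hr₀ ht₀ ht₀T hd hc hsmooth hii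
  refine h hT hLH hu₀ hω₀ x₀ t₀ r₀ d hr₀ ht₀ ht₀T hd hsmooth ?_
  -- the weak-`L^{6/5}` constant
  set V₁ : ℝ≥0∞ := volume (ball (0 : EuclideanSpace ℝ (Fin 3)) 1) with hV₁
  set V₃ : ℝ≥0∞ := volume (ball (0 : EuclideanSpace ℝ (Fin 3)) (3 * r₀)) with hV₃
  have hV₁fin : V₁ < ∞ := measure_ball_lt_top
  have hV₃fin : V₃ < ∞ := measure_ball_lt_top
  refine ⟨ENNReal.ofReal (c ^ (6 / 5 : ℝ)) * V₁ +
    ENNReal.ofReal (((r₀ ^ 3)⁻¹) ^ (6 / 5 : ℝ)) * V₃, ?_, fun s hs => ?_⟩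
  · exact ENNReal.add_lt_top.2
      ⟨ENNReal.mul_lt_top ENNReal.ofReal_lt_top hV₁fin,
        ENNReal.mul_lt_top ENNReal.ofReal_lt_top hV₃fin⟩
  -- bound the super-level set by the two balls
  have hsub := GrujicZhang2006.superlevel_depletionFactor_subset_of_halfHolder
    (u := u) (x₀ := x₀) (t₀ := t₀) (d := d) hr₀ hc hii hs
  have hR : 0 ≤ (c / s) ^ (2 / 5 : ℝ) := Real.rpow_nonneg (div_pos hc hs).le _
  have hdim : Module.finrank ℝ (EuclideanSpace ℝ (Fin 3)) = 3 := by simp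
  -- first ball: `s^{6/5} |B(0,(c/s)^{2/5})| = c^{6/5} |B(0,1)|`
  have hA : ENNReal.ofReal s ^ (6 / 5 : ℝ) *
      volume (ball (0 : EuclideanSpace ℝ (Fin 3)) ((c / s) ^ (2 / 5 : ℝ))) =
      ENNReal.ofReal (c ^ (6 / 5 : ℝ)) * V₁ := by
    rw [Measure.addHaar_ball volume _ hR, hdim, ← mul_assoc, ENNReal.ofReal_rpow_of_pos hs,
      ← ENNReal.ofReal_mul (Real.rpow_nonneg hs.le _)]
    congr 2
    rw [← Real.rpow_natCast, ← Real.rpow_mul (div_pos hc hs).le]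
    norm_num
    rw [← Real.mul_rpow hs.le (div_pos hc hs).le, mul_div_cancel₀ _ hs.ne']
  -- second piece: `s^{6/5} |if s < r₀⁻³ then B(0,3r₀) else ∅| ≤ r₀^{-18/5} |B(0,3r₀)|`
  have hB : ENNReal.ofReal s ^ (6 / 5 : ℝ) *
      volume (if s < (r₀ ^ 3)⁻¹ then ball (0 : EuclideanSpace ℝ (Fin 3)) (3 * r₀) else ∅) ≤
      ENNReal.ofReal (((r₀ ^ 3)⁻¹) ^ (6 / 5 : ℝ)) * V₃ := by
    split_ifs with hsr
    · refine mul_le_mul' ?_ le_rfl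
      rw [ENNReal.ofReal_rpow_of_pos hs]
      exact ENNReal.ofReal_le_ofReal (Real.rpow_le_rpow hs.le hsr.le (by norm_num))
    · simp
  calc ENNReal.ofReal s ^ (6 / 5 : ℝ) *
        volume {y ∈ ball (0 : EuclideanSpace ℝ (Fin 3)) (3 * r₀) |
          ENNReal.ofReal s < GrujicZhang2006.depletionFactor u x₀ t₀ r₀ d y}
      ≤ ENNReal.ofReal s ^ (6 / 5 : ℝ) *
          (volume (ball (0 : EuclideanSpace ℝ (Fin 3)) ((c / s) ^ (2 / 5 : ℝ))) +
            volume (if s < (r₀ ^ 3)⁻¹ then ball (0 : EuclideanSpace ℝ (Fin 3)) (3 * r₀) else ∅)) :=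
        mul_le_mul' le_rfl ((measure_mono hsub).trans (measure_union_le _ _))
    _ = ENNReal.ofReal s ^ (6 / 5 : ℝ) *
          volume (ball (0 : EuclideanSpace ℝ (Fin 3)) ((c / s) ^ (2 / 5 : ℝ))) +
        ENNReal.ofReal s ^ (6 / 5 : ℝ) *
          volume (if s < (r₀ ^ 3)⁻¹ then ball (0 : EuclideanSpace ℝ (Fin 3)) (3 * r₀) else ∅) :=
        mul_add _ _ _
    _ ≤ ENNReal.ofReal (c ^ (6 / 5 : ℝ)) * V₁ +
        ENNReal.ofReal (((r₀ ^ 3)⁻¹) ^ (6 / 5 : ℝ)) * V₃ := by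
        rw [hA]; exact add_le_add le_rfl hB

end Literature.Analysis.FluidPDE

end
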